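import Literature.Probability.RandomPlanarGeometry.SAWWordAutomataZd
import Mathlib.Analysis.SpecialFunctions.Pow.Real
import Std.Data.HashMap
import HarnessLib

/-!
# Finite-memory automata on `ℤ³` (Pönitz–Tittmann) and certified upper bounds `μ(ℤ³) ≤ N/D`

Topic `Literature/Probability/RandomPlanarGeometry` (continues `SAWWordAutomataZd.lean`; the three-dimensional twin of
`SAWFiniteMemory.lean`, which does `ℤ²`).  Pönitz and Tittmann (2000) bound the connective constant from above by the growth rate
of the *walks with memory `k`* (no loop of length `≤ k`), computed as the largest eigenvalue of an automatically generated automaton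
whose states are the walk suffixes that can still be closed to a loop within the memory (`|s| + ‖end s‖₁ ≤ k`); their Table 2 gives
`μ(3) ≤ 4.8646, 4.8075, 4.7780, 4.7599, 4.7476, 4.7387` for `k = 4, 6, …, 14`.  This file makes such bounds kernel-checkable on `ℤ³`:

* `FiniteMemory3.ptStep K` — the automaton on step words over `Fin 3 × Bool` (`SAWWordsZd.lean`): append the letter, kill the run if
  the suffix closes a loop, otherwise truncate to the longest closable suffix; **every self-avoiding word survives**
  (`run_ne_none_of_isSAW`: the state is always a suffix of the input, and a suffix of a self-avoiding word is self-avoiding);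
* `FiniteMemory3.check K N D iters` — an executable certificate check: an (untrusted) breadth-first search enumerates the reachable
  states and an integer power iteration proposes a weight `v`; the (verified) function `verify` then checks closure and the
  Collatz–Wielandt inequalities `D Σ_a v(ptStep s a) ≤ N v(s)`, i.e. a `WordAutomaton.Certificate`;
* `count_mul_pow_le_of_check : check K N D iters = true → cₙ Dⁿ ≤ Nⁿ 2⁴¹` and
  **`connectiveConstant_le_of_check : check K N D iters = true → μ(ℤ³) ≤ N/D`**.

The evaluations (`native_decide`) live in separate files (`SAWFiniteMemoryZ3K8.lean`, …: `k = 8`: 9 505 states, `k = 10`: 139 183 states).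

## References

* A. Pönitz, P. Tittmann, *Improved upper bounds for self-avoiding walks in ℤᵈ*, Electron. J. Combin. 7 (2000) R21, §2 (the
  automaton), §3 (eigenvalue bound), Table 2. [PonitzTittmann2000]
* N. Madras, G. Slade, *The Self-Avoiding Walk* (1993), §1.2 (`μ = infₙ cₙ^{1/n}`, finite-memory bounds). [MadrasSlade1993]
-/

open Finset Filter Topology Literature.Probability.LatticeModels Literature.Probability.Percolation
open scoped BigOperators

namespace Literature.Probability.RandomPlanarGeometry.SAW.Zd

namespace FiniteMemory3

/-! ### Integer-triple coordinates (the executable model) -/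

/-- The triple of coordinates of a site of `ℤ³`. [folklore] -/
def toTriple (x : Site 3) : ℤ × ℤ × ℤ := (x 0, x 1, x 2)

/-- `toTriple` is injective. [cite: PonitzTittmann2000, §2–§3] -/
theorem toTriple_injective : Function.Injective toTriple := by
  intro x y h
  simp only [toTriple, Prod.mk.injEq] at h
  funext i
  fin_cases i
  · exact h.1
  · exact h.2.1
  · exact h.2.2

/-- Coordinate `i` of the unit step `a`: `±1` on the axis of `a`, `0` elsewhere. [folklore] -/
def dz (a : Fin 3 × Bool) (i : Fin 3) : ℤ := if i = a.1 then (if a.2 then 1 else -1) else 0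

/-- `stepVec a i = dz a i`. [cite: PonitzTittmann2000, §2–§3] -/
theorem stepVec_apply (a : Fin 3 × Bool) (i : Fin 3) : stepVec a i = dz a i := by
  obtain ⟨j, b⟩ := a
  unfold stepVec dz
  by_cases h : i = j <;> cases b <;> simp [h]

/-- Move the triple `p` by one step `a`. [folklore] -/
def pmove (a : Fin 3 × Bool) (p : ℤ × ℤ × ℤ) : ℤ × ℤ × ℤ := (p.1 + dz a 0, p.2.1 + dz a 1, p.2.2 + dz a 2)

/-- `toTriple (x + stepVec a) = pmove a (toTriple x)`. [cite: PonitzTittmann2000, §2–§3] -/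
@[simp] theorem toTriple_add_stepVec (x : Site 3) (a : Fin 3 × Bool) : toTriple (x + stepVec a) = pmove a (toTriple x) := by
  simp [toTriple, pmove, stepVec_apply]

/-- Endpoint of a word in triple coordinates (left fold). [folklore] -/
def pEnd (s : List (Fin 3 × Bool)) : ℤ × ℤ × ℤ := s.foldl (fun p a => pmove a p) (0, 0, 0)

/-- The visited sites of a word in triple coordinates (`List.scanl`). [folklore] -/
def pVerts (s : List (Fin 3 × Bool)) : List (ℤ × ℤ × ℤ) := s.scanl (fun p a => pmove a p) (0, 0, 0)

/-- `ℓ¹` distance of two triples. [folklore] -/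
def dist1 (p q : ℤ × ℤ × ℤ) : ℕ := (p.1 - q.1).natAbs + (p.2.1 - q.2.1).natAbs + (p.2.2 - q.2.2).natAbs

/-- Folding the steps of `s` from `toTriple x` reaches `toTriple (x + wEnd s)`. [cite: PonitzTittmann2000, §2–§3] -/
theorem foldl_pmove_eq (s : List (Fin 3 × Bool)) (x : Site 3) :
    s.foldl (fun p a => pmove a p) (toTriple x) = toTriple (x + Word.wEnd s) := by
  induction s generalizing x with
  | nil => simp
  | cons a s ih =>
    rw [List.foldl_cons, ← toTriple_add_stepVec, ih, Word.wEnd_cons, add_assoc]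

/-- `pEnd s = toTriple (wEnd s)`. [cite: PonitzTittmann2000, §2–§3] -/
theorem pEnd_eq (s : List (Fin 3 × Bool)) : pEnd s = toTriple (Word.wEnd s) := by
  have := foldl_pmove_eq s 0
  rw [zero_add] at this
  rw [← this, pEnd]
  rfl

/-- Membership in a `scanl`: the partial folds. [folklore] -/
private theorem mem_scanl_iff {α β : Type*} (f : β → α → β) (b : β) (l : List α) (q : β) :
    q ∈ List.scanl f b l ↔ ∃ i ≤ l.length, q = List.foldl f b (l.take i) := by
  induction l generalizing b with
  | nil => simp
  | cons x l ih =>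
    rw [List.scanl_cons, List.mem_cons, ih]
    constructor
    · rintro (rfl | ⟨i, hi, rfl⟩)
      · exact ⟨0, Nat.zero_le _, rfl⟩
      · exact ⟨i + 1, by simpa using hi, rfl⟩
    · rintro ⟨i, hi, rfl⟩
      cases i with
      | zero => exact Or.inl rfl
      | succ i => exact Or.inr ⟨i, by simpa using hi, rfl⟩

/-- The sites of `pVerts s` are the `toTriple (traj s i)`, `i ≤ |s|`. [cite: PonitzTittmann2000, §2–§3] -/
theorem mem_pVerts_iff (s : List (Fin 3 × Bool)) (q : ℤ × ℤ × ℤ) :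
    q ∈ pVerts s ↔ ∃ i ≤ s.length, q = toTriple (Word.traj s i) := by
  rw [pVerts, mem_scanl_iff]
  refine exists_congr fun i => and_congr_right fun _ => ?_
  have := foldl_pmove_eq (s.take i) 0
  rw [zero_add] at this
  rw [Word.traj, ← this]
  rfl

/-! ### The Pönitz–Tittmann automaton -/

/-- **One step of the memory-`K` automaton on `ℤ³`** (Pönitz–Tittmann 2000, §2): from the state `s` (the remembered suffix) on the
letter `a`, kill the run if the new endpoint is a site of `s` (a loop of length `≤ K` closes), otherwise keep the longest suffix `b` of
`s ++ [a]` with `|b| + ‖start b − end b‖₁ ≤ K`. [cite: PonitzTittmann2000, §2] -/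
def ptStep (K : ℕ) (s : List (Fin 3 × Bool)) (a : Fin 3 × Bool) : Option (List (Fin 3 × Bool)) :=
  let e := pmove a (pEnd s)
  let vs := pVerts s
  if e ∈ vs then none
  else
    let L := s.length + 1
    let j := ((vs.zipIdx).takeWhile fun pi => decide (K < (L - pi.2) + dist1 pi.1 e)).length
    some ((s ++ [a]).drop j)

/-- The new state is a suffix of the old state with the letter appended. [cite: PonitzTittmann2000, §2–§3] -/
theorem ptStep_suffix {K : ℕ} {s b : List (Fin 3 × Bool)} {a : Fin 3 × Bool} (h : ptStep K s a = some b) :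
    b <:+ s ++ [a] := by
  unfold ptStep at h
  simp only at h
  split_ifs at h
  rw [Option.some.injEq] at h
  rw [← h]
  exact List.drop_suffix _ _

/-- A self-avoiding input is never killed: if `s ++ [a]` is self-avoiding then `ptStep K s a` is defined. [cite: PonitzTittmann2000, §2] -/
theorem ptStep_ne_none {K : ℕ} {s : List (Fin 3 × Bool)} {a : Fin 3 × Bool} (h : Word.IsSAW (s ++ [a])) :
    ptStep K s a ≠ none := by
  unfold ptStep
  simp only
  split_ifs with hmem
  · exfalso
    obtain ⟨i, hi, he⟩ := (mem_pVerts_iff s _).1 hmem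
    rw [pEnd_eq, ← toTriple_add_stepVec] at he
    have he' := toTriple_injective he
    have h1 : Word.traj (s ++ [a]) (s.length + 1) = Word.wEnd s + stepVec a := by
      rw [Word.traj_append_right s [a] 1]
      simp [Word.traj]
    have h2 : Word.traj (s ++ [a]) i = Word.traj s i := Word.traj_append_left s [a] hi
    have hinj := (Word.isSAW_iff_injOn _).1 h
    have := hinj (show s.length + 1 ∈ {j | j ≤ (s ++ [a]).length} by simp)
      (show i ∈ {j | j ≤ (s ++ [a]).length} by simp; omega) (by rw [h1, h2, he'])
    omega
  · exact Option.some_ne_none _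

/-- **Every self-avoiding word survives the memory-`K` automaton**, and its state is a suffix of the word read.
[cite: PonitzTittmann2000, §2] -/
theorem run_eq_some_of_isSAW (K : ℕ) (w : List (Fin 3 × Bool)) (h : Word.IsSAW w) :
    ∃ s, WordAutomaton.run (ptStep K) w = some s ∧ s <:+ w := by
  induction w using List.reverseRecOn with
  | nil => exact ⟨[], rfl, List.suffix_refl _⟩
  | append_singleton w a ih =>
    have hw : Word.IsSAW w := by simpa using h.take w.length
    obtain ⟨s, hs, hsuf⟩ := ih hw
    obtain ⟨t, rfl⟩ := hsuf
    have hsa : Word.IsSAW (s ++ [a]) := by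
      have := h.drop t.length
      simpa using this
    cases hst : ptStep K s a with
    | none => exact absurd hst (ptStep_ne_none hsa)
    | some b =>
      refine ⟨b, by rw [WordAutomaton.run_append_singleton, hs, Option.bind_some, hst], ?_⟩
      exact (ptStep_suffix hst).trans ⟨t, (List.append_assoc t s [a]).symm⟩

/-- Self-avoiding words are live for `ptStep K`. [cite: PonitzTittmann2000, §2] -/
theorem run_ne_none_of_isSAW (K : ℕ) (w : List (Fin 3 × Bool)) (h : Word.IsSAW w) :
    WordAutomaton.run (ptStep K) w ≠ none := by
  obtain ⟨s, hs, -⟩ := run_eq_some_of_isSAW K w h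
  rw [hs]
  exact Option.some_ne_none s

/-! ### The six letters -/

/-- The six letters `±e₀, ±e₁, ±e₂`. [folklore] -/
def letters : List (Fin 3 × Bool) := [(0, true), (0, false), (1, true), (1, false), (2, true), (2, false)]

/-- Every letter is in the list. [cite: PonitzTittmann2000, §2–§3] -/
theorem mem_letters (a : Fin 3 × Bool) : a ∈ letters := by
  obtain ⟨i, b⟩ := a
  fin_cases i <;> cases b <;> simp [letters]

/-- Summing over the list of letters is summing over the alphabet. [cite: PonitzTittmann2000, §2–§3] -/
theorem sum_letters_map (f : Fin 3 × Bool → ℕ) : (letters.map f).sum = ∑ a : Fin 3 × Bool, f a := by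
  rw [Fintype.sum_prod_type, Fin.sum_univ_three, Fintype.sum_bool, Fintype.sum_bool, Fintype.sum_bool]
  simp [letters]
  ring

/-! ### The certificate: untrusted search -/

/-- Breadth-first enumeration of the states reachable from `[]` (fuelled; untrusted — only its output is checked).
[cite: PonitzTittmann2000, §2] -/
def bfs (K : ℕ) : Array (List (Fin 3 × Bool)) × Std.HashMap (List (Fin 3 × Bool)) ℕ := Id.run do
  let mut states : Array (List (Fin 3 × Bool)) := #[[]]
  let mut idx : Std.HashMap (List (Fin 3 × Bool)) ℕ := (Std.HashMap.emptyWithCapacity 1000000).insert [] 0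
  let mut i := 0
  let mut fuel := 40000000
  while i < states.size && fuel > 0 do
    fuel := fuel - 1
    let s := states[i]!
    for a in letters do
      match ptStep K s a with
      | none => pure ()
      | some b =>
        if !idx.contains b then
          idx := idx.insert b states.size
          states := states.push b
    i := i + 1
  return (states, idx)

/-- Successor indices of every state (untrusted). [folklore] -/
def transTable (K : ℕ) (states : Array (List (Fin 3 × Bool))) (idx : Std.HashMap (List (Fin 3 × Bool)) ℕ) :
    Array (Array ℕ) :=
  states.map fun s => Id.run do
    let mut acc : Array ℕ := #[]
    for a in letters do
      match ptStep K s a with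
      | none => pure ()
      | some b => acc := acc.push (idx.getD b 0)
    return acc

/-- Integer power iteration towards the Perron eigenvector, normalised to `max ≈ 2⁴⁰`, entries `≥ 1` (untrusted).
[cite: PonitzTittmann2000, §3] -/
def powerIter (T : Array (Array ℕ)) (iters : ℕ) : Array ℕ := Id.run do
  let n := T.size
  let mut v : Array ℕ := Array.replicate n (2 ^ 20)
  for _ in [0:iters] do
    let mut w : Array ℕ := Array.replicate n 0
    let mut mx : ℕ := 1
    for i in [0:n] do
      let s := (T[i]!).foldl (fun acc j => acc + v[j]!) 0
      w := w.set! i s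
      if s > mx then mx := s
    v := w.map fun s => s * 2 ^ 40 / mx + 1
  return v

/-- The search: states, index, proposed weights (untrusted). [folklore] -/
def search (K iters : ℕ) : Array (List (Fin 3 × Bool)) × Std.HashMap (List (Fin 3 × Bool)) ℕ × Array ℕ :=
  let (states, idx) := bfs K
  (states, idx, powerIter (transTable K states idx) iters)

/-! ### The certificate: verified check -/

/-- The weight function encoded by the arrays: `v[idx[s]]` (`0` off the table). [folklore] -/
def weightOf (idx : Std.HashMap (List (Fin 3 × Bool)) ℕ) (v : Array ℕ) (s : List (Fin 3 × Bool)) : ℕ :=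
  match idx[s]? with
  | none => 0
  | some j => v[j]?.getD 0

/-- Check of the state number `i`: consistent index, positive weight, successors in the table, Collatz–Wielandt inequality.
[cite: PonitzTittmann2000, §3] -/
def verifyState (K N D : ℕ) (states : Array (List (Fin 3 × Bool))) (idx : Std.HashMap (List (Fin 3 × Bool)) ℕ)
    (v : Array ℕ) (i : ℕ) : Bool :=
  match states[i]?, v[i]? with
  | some s, some vi =>
    decide (idx[s]? = some i) && decide (1 ≤ vi) &&
      letters.all (fun a =>
        match ptStep K s a with
        | none => true
        | some b =>
          match idx[b]? with
          | none => false
          | some j => decide (states[j]? = some b)) &&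
      decide (D * (letters.map fun a => ((ptStep K s a).map (weightOf idx v)).getD 0).sum ≤ N * vi)
  | _, _ => false

/-- The verified part of the certificate check. [cite: PonitzTittmann2000, §3] -/
def verify (K N D : ℕ) (states : Array (List (Fin 3 × Bool))) (idx : Std.HashMap (List (Fin 3 × Bool)) ℕ)
    (v : Array ℕ) : Bool :=
  decide (states[0]? = some []) && decide (weightOf idx v [] ≤ 2 ^ 41) &&
    (List.range states.size).all (verifyState K N D states idx v)

/-- **The certificate check** `check K N D iters`: search, then verify.  Only ever evaluated by `native_decide` (see
`SAWFiniteMemoryZ3K8.lean`). [cite: PonitzTittmann2000, §3] -/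
@[irreducible] def check (K N D iters : ℕ) : Bool :=
  let r := search K iters
  verify K N D r.1 r.2.1 r.2.2

/-- **Soundness of `verify`**: a successful check yields a Collatz–Wielandt certificate for `ptStep K` on the set of tabulated
states, with `v([]) ≤ 2⁴¹`. [cite: PonitzTittmann2000, §3] -/
theorem certificate_of_verify {K N D : ℕ} {states : Array (List (Fin 3 × Bool))}
    {idx : Std.HashMap (List (Fin 3 × Bool)) ℕ} {v : Array ℕ} (h : verify K N D states idx v = true) :
    WordAutomaton.Certificate (ptStep K) {s | ∃ i < states.size, states[i]? = some s}
      (weightOf idx v) N D ∧ weightOf idx v [] ≤ 2 ^ 41 := by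
  simp only [verify, Bool.and_eq_true, decide_eq_true_eq, List.all_eq_true, List.mem_range] at h
  obtain ⟨⟨h0, hroot⟩, hall⟩ := h
  -- unpack the check of a tabulated state
  have key : ∀ s : List (Fin 3 × Bool), ∀ i < states.size, states[i]? = some s →
      idx[s]? = some i ∧ 1 ≤ weightOf idx v s ∧
      (∀ a b, ptStep K s a = some b → ∃ j < states.size, states[j]? = some b) ∧
      D * ∑ a : Fin 3 × Bool, ((ptStep K s a).map (weightOf idx v)).getD 0 ≤ N * weightOf idx v s := by
    intro s i hi hs
    have hst := hall i hi
    unfold verifyState at hst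
    rw [hs] at hst
    cases hv : v[i]? with
    | none => simp [hv] at hst
    | some vi =>
      simp only [hv, Bool.and_eq_true, decide_eq_true_eq, List.all_eq_true] at hst
      obtain ⟨⟨⟨hidx, hvi⟩, hsucc⟩, hcw⟩ := hst
      have hw : weightOf idx v s = vi := by simp [weightOf, hidx, hv]
      refine ⟨hidx, hw ▸ hvi, fun a b hb => ?_, ?_⟩
      · have := hsucc a (mem_letters a)
        rw [hb] at this
        cases hj : idx[b]? with
        | none => simp [hj] at this
        | some j =>
          simp only [hj, decide_eq_true_eq] at this
          exact ⟨j, (Array.getElem?_eq_some_iff.1 this).1, this⟩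
      · rw [hw, ← sum_letters_map]
        exact hcw
  refine ⟨⟨?_, ?_, ?_, ?_⟩, hroot⟩
  · exact ⟨0, (Array.getElem?_eq_some_iff.1 h0).1, h0⟩
  · rintro s ⟨i, hi, hs⟩ a b hb
    exact (key s i hi hs).2.2.1 a b hb
  · rintro s ⟨i, hi, hs⟩
    exact (key s i hi hs).2.1
  · rintro s ⟨i, hi, hs⟩
    exact (key s i hi hs).2.2.2

/-- **`cₙ · Dⁿ ≤ Nⁿ · 2⁴¹`** (`cₙ = SAW.Zd.count 3 n`) from a successful certificate check. [cite: PonitzTittmann2000, §3] -/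
theorem count_mul_pow_le_of_check {K N D iters : ℕ} (h : check K N D iters = true) (n : ℕ) :
    count 3 n * D ^ n ≤ N ^ n * 2 ^ 41 := by
  rw [check] at h
  obtain ⟨hc, hroot⟩ := certificate_of_verify h
  exact le_trans (WordAutomaton.count_mul_pow_le hc (run_ne_none_of_isSAW K) n)
    (Nat.mul_le_mul_left _ hroot)

/-! ### The bound on the connective constant -/

/-- **`μ(ℤ³) ≤ N/D` from a successful certificate check** (`cₙ ≤ 2⁴¹ (N/D)ⁿ`, `cₙ^{1/n} → μ(3)`: `connectiveConstant_le_of_count_le`).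
[cite: PonitzTittmann2000, §3] -/
theorem connectiveConstant_le_of_check {K N D iters : ℕ} (h : check K N D iters = true) (hD : 0 < D) :
    connectiveConstant 3 ≤ (N : ℝ) / D := by
  refine connectiveConstant_le_of_count_le (d := 3) (C := (2 : ℝ) ^ 41) (by positivity) (by positivity) fun n _ => ?_
  have h1 := count_mul_pow_le_of_check h n
  have h2 : (count 3 n : ℝ) * (D : ℝ) ^ n ≤ (N : ℝ) ^ n * 2 ^ 41 := by exact_mod_cast h1
  have hDn : (0 : ℝ) < (D : ℝ) ^ n := by positivity
  rw [div_pow, mul_div_assoc', le_div_iff₀ hDn]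
  linarith

end FiniteMemory3

end Literature.Probability.RandomPlanarGeometry.SAW.Zd
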